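import Summits.BirchSwinnertonDyer.BirchSwinnertonDyer.Theorems.KatoDescentPotSupersingularFineSelmerLeSignedSelmer
import Summits.BirchSwinnertonDyer.BirchSwinnertonDyer.Theorems.KatoDescentPotSupersingularWildFineSelmerCongruenceFact
import Summits.BirchSwinnertonDyer.Rank1Residual.Additive.StrictSignedSelmerPreimageZeroPadic
import Summits.BirchSwinnertonDyer.Rank1Residual.Supersingular.KobayashiMainConjecture
import Literature.NumberTheory.EllipticCurves.PollackRubin2004.SignedMainTheoremCM
import Literature.NumberTheory.EllipticCurves.Kobayashi2003.SignedSelmerDualExistsProofs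
import Literature.NumberTheory.EllipticCurves.Kobayashi2003.SignedSelmerModuleFiniteProofs
import Literature.NumberTheory.EllipticCurves.IwasawaAlgebraMuVanishingProofs
import Literature.NumberTheory.EllipticCurves.KatoRankBoundSelmerProofs
import Literature.NumberTheory.EllipticCurves.KatoRankBoundProofs
import Literature.NumberTheory.EllipticCurves.IwasawaOrderOfVanishingProofs
import HarnessLib

/-!
# The SUPERSINGULAR (CM, Pollack–Rubin) ANCHOR road to the Conj-A crux `WildFineSelmerCoatesSujatha`
# (item stmt-BirchSwinnertonDyer-19386; route `KatoDescentPotSupersingular`, rung K9, cell `bsd-potss`):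
# signed `μ = 0` at an anchor ⟹ `Sel^ε(W′/ℚ_∞)[p]` finite ⟹ (A) at `(W′,p)` ⟹ (A) at the ♯ row ⟹ Upper
# (a `--supports … --as helper` file; seat `bsd-potss-k9-c4` g5; ROUTE-FREE; nothing booked, BSD is not
# proved by any of this)

WHY. On the 3Nn Cartan rows of the crux (95 of the 163 ♯ rows: `W[3]` irreducible with image the
normaliser of a NON-split Cartan, 3-adic tower not onto) every CM partner `W′` with `W′[3] ≃ W[3]` has
`3` INERT in its CM field, i.e. GOOD SUPERSINGULAR reduction at `3` with `a₃ = 0` (census of seat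
`bsd-potss-conjA-anchor`, 342 (row, anchor) pairs). Their cyclotomic Iwasawa theory is Kobayashi's
`Sel^±`; the CM case of Kobayashi's main conjecture is a THEOREM (Pollack–Rubin 2004, tree fact
`PollackRubin2004.mainTheorem_signedCharIdeal_eq_of_cm`: `X^ε` is `Λ`-torsion with
`char X^ε = (ϖ · L^{∓})`, Pollack's `L^±`, `ϖ · Ω_E = Ω⁺_f`). With the kernel bridge of this seat
(`FineSelmerLeSignedSelmer.fineSelmerInfty_le_signedSelmerInfty`, p466275: `Sel₀ ⊆ Sel^ε`) such an
anchor certifies Coates–Sujatha's (A) exactly like the ordinary unit anchors of g4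
(`…WildFineSelmerOrdinaryUnitAnchor.lean`): this file is the supersingular twin of that file.

* §1 (any number field `K`, any `ℤ_p`-extension, any sign) `finite_signedSelmerInfty_pTorsion_of_isTorsion_of_muInvariant_eq_zero`:
  **`X^ε(E/K_∞)` `Λ`-torsion with `μ = 0` ⟹ `Sel^ε(E/K_∞)[p]` finite** (for the tree's concrete datum
  `Kobayashi2003.signedSelmerDualData`, whose module is LITERALLY `Hom(Sel^ε_∞, ℚ/ℤ)`): `X^ε` is
  finitely generated over `Λ` (tree theorem `SignedSelmerDualData.moduleFinite`, unconditional), so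
  `μ = 0` makes it finitely generated over `ℤ_p` (`X2.NonPrimitiveSelmerTorsionCard`), `X^ε/p` is
  finite (`ZpCorank.natCard_modN_le`) and `#(X^ε/p) = #Sel^ε_∞[p]` (Pontryagin,
  `Iwasawa.natCard_modN_characterModule_eq`); variant `…_of_charIdeal_eq_span_of_isUnit_coeff` (a UNIT
  COEFFICIENT of a characteristic power series, `muInvariant_eq_zero_iff_exists_isUnit_coeff_of_charIdeal_eq_span`).
* §2 (over `ℚ`, CM, `p` odd good supersingular) `finite_signedSelmerInfty_pTorsion_of_pollackRubin`:
  granted Pollack–Rubin (`hPR`), at the normalised cyclotomic datum `(κ, γ)` (`κ γ = 1`, `γ` a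
  cyclotomic variable — the fact's binders): a newform `f` of `W′`, `ϖ` with `ϖ·Ω = Ω⁺_f`, a Pollack
  pair `(L⁺, L⁻)` (`Supersingular.IsPollackPair`) and ONE index `k` with
  `‖ϖ · [T^k] L^{∓}‖_p = 1` (the census's `μ^± = 0` certificate, PARI `ellpadiclambdamu`) give
  `Sel^ε(W′/ℚ_∞)[p]` finite; `conjA_rat_of_pollackRubin` — hence (A) at `(W′,p)` for EVERY cyclotomic
  `κ` (the fine Selmer group only sees `ker κ`, `finite_fineSelmerInfty_pTorsion_of_kerSubgroup_eq`;
  the finite bad set is discharged by x1b's `exists_finset_forall_not_mem_good`).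
* §3 the hypothesis-(hS)-free forms of the bridge: `fineSelmerInfty_le_signedSelmerInfty'`,
  `conjA_rat_of_finite_signedSelmerInfty_pTorsion'`.
* §4 the ROW ROAD: `missingUpperBoundAt_wild_of_conjA` (Upper at a wild irreducible `r_an = 0` row from
  (A) AT THE ROW, below p420034 + GZK + modularity — g3's chain made public) and
  **`missingUpperBoundAt_wild_of_supersingularCMAnchor`**: Upper at the ♯ row `W` ⟸ {LS18 `hLS`
  (p445851), Kato fine reading `hKatoA` (p420034), Pollack–Rubin `hPR`, GZK, modularity} + ONE
  congruent CM good-supersingular anchor `W′` (`O6.ModPCongruent W′ W 3`, `a₃(W′) = 0`) with its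
  newform/period/Pollack-pair data and ONE unit coefficient of `ϖ·L^{∓}`. Class form: feed
  `conjA_rat_of_pollackRubin` into g3's `WildFineSelmerCongruenceFact.wildFineSelmerCoatesSujatha_of_mixedCertificates`
  (its (A)-disjunct), no new class theorem needed.

HONEST FRAMING: conditional-results on the displayed named facts (all published theorems already
typed in the tree; no new fact); the per-row data (congruence, newform, `ϖ`, Pollack pair, unit
coefficient) are hypotheses — data of record from the census, not kernel inputs; items 19386/19197
are NOT closed; class-wide the crux remains Coates–Sujatha (A), a named open problem.
References: [PollackRubin2004] Theorem (p. 448) = Thm. 7.3; [Kobayashi2003] Def. 1.1, Thm. 1.2, (3.6);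
[Pollack2003] Thm. 5.6, Cor. 5.11; [CoatesSujatha2005] §3; [LimSujatha2018] §3 Prop. 3.2;
[Kato2004Asterisque] Thm. 14.5 (3), Prop. 14.16 (2); [GreenbergVatsal2000] Prop. (2.8); [Washington1997] §13.2.
-/

set_option autoImplicit false
-- sibling precedent (`KatoDescentPotSupersingularAssembly.lean`): the directory name repeats the summit name
set_option linter.dupNamespace false

noncomputable section

open scoped Classical AddSubgroup MatrixGroups ModularForm

universe u

namespace Summit.BirchSwinnertonDyer.BirchSwinnertonDyer.Theorems.WildFineSelmerSupersingularCMAnchor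

open CongruenceSubgroup NumberField IsDedekindDomain Field
open WeierstrassCurve Literature.NumberTheory.EllipticCurves
  Literature.NumberTheory.EllipticCurves.IwasawaAlgebra
  Literature.NumberTheory.EllipticCurves.ModularForms
  Literature.NumberTheory.EllipticCurves.Rank1Residual
  Literature.NumberTheory.EllipticCurves.Rank1Residual.Typed
  Literature.NumberTheory.EllipticCurves.Kobayashi2003 Literature.NumberTheory.EllipticCurves.ZpExtension
  Summit.BirchSwinnertonDyer.Rank1Residual Summit.BirchSwinnertonDyer.Rank1Residual.Additive
  Summit.BirchSwinnertonDyer.Rank1Residual.O6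
  Summit.BirchSwinnertonDyer.BirchSwinnertonDyer.Theorems

/-! ## §1 `X^ε` torsion with `μ = 0` ⟹ `Sel^ε(E/K_∞)[p]` finite -/

section SignedMuZero

variable {K : Type u} [Field K] [NumberField K] (W : WeierstrassCurve K) [W.IsElliptic] {p : ℕ}
  [Fact p.Prime] (κ : ZpExtension K p) (ε : ℤˣ)

/-- **Signed `μ = 0` with cotorsion ⟹ `Sel^ε(E/K_∞)[p]` finite.** For `W/K` elliptic, `κ` a
`ℤ_p`-extension with topological generator `γ`, a sign `ε`, and the tree's Iwasawa module
`X^ε = Hom(Sel^ε(E/K_∞), ℚ/ℤ)` (`Kobayashi2003.signedSelmerDualData`): if `X^ε` is `Λ`-torsion with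
`μ(X^ε) = 0` then the `p`-torsion classes of `Sel^ε(E/K_∞)` form a finite set. (`X^ε` is finitely
generated over `Λ` unconditionally, `SignedSelmerDualData.moduleFinite`; `μ = 0` ⟹ f.g./`ℤ_p` ⟹
`X^ε/p` finite ⟹ `#Sel^ε_∞[p] = #(X^ε/p)`.) [cite: Kobayashi2003, Def. 1.1 and Thm. 1.2]
[cite: Washington1997, §13.2 (μ = 0 ⟺ finitely generated over ℤ_p)] -/
theorem finite_signedSelmerInfty_pTorsion_of_isTorsion_of_muInvariant_eq_zero
    {γ : absoluteGaloisGroup K} (hγ : κ.IsTopGenerator γ)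
    (hT : Module.IsTorsion (IwasawaAlgebra p) (signedSelmerDualData W κ ε hγ).X)
    (hμ : muInvariant p (signedSelmerDualData W κ ε hγ).X = 0) :
    Set.Finite {s : signedSelmerInfty W κ ε | p • s = 0} := by
  set D : SignedSelmerDualData W κ γ ε := signedSelmerDualData W κ ε hγ with hD
  haveI hfg : Module.Finite (IwasawaAlgebra p) D.X := D.moduleFinite hγ
  letI : Module ℤ_[p] D.X := Module.compHom D.X (algebraMap ℤ_[p] (IwasawaAlgebra p))
  haveI hfgZp : Module.Finite ℤ_[p] D.X :=
    X2.NonPrimitiveSelmerTorsionCard.moduleFinite_int_of_muInvariant_eq_zero p D.X hT hμ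
  have hmodN : Finite (ModN D.X p) := (ZpCorank.natCard_modN_le p D.X).1
  have hmodN' : Finite (ModN (CharacterModule (signedSelmerInfty W κ ε)) p) := hmodN
  have hcard : Nat.card (ModN (CharacterModule (signedSelmerInfty W κ ε)) p) =
      Nat.card ((signedSelmerInfty W κ ε)[(p : ℤ)]) :=
    Iwasawa.natCard_modN_characterModule_eq p (signedSelmerInfty W κ ε)
  haveI hfinT : Finite ((signedSelmerInfty W κ ε)[(p : ℤ)]) := by
    apply Nat.finite_of_card_ne_zero
    rw [← hcard]
    exact Nat.card_pos.ne'
  have hset : {s : signedSelmerInfty W κ ε | p • s = 0} =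
      (((signedSelmerInfty W κ ε)[(p : ℤ)] : AddSubgroup (signedSelmerInfty W κ ε)) :
        Set (signedSelmerInfty W κ ε)) := by
    ext s
    rw [Set.mem_setOf_eq, SetLike.mem_coe, AddSubgroup.torsionBy.nsmul_iff]
  rw [hset]
  exact Set.toFinite _

/-- **A unit coefficient of a characteristic power series ⟹ `Sel^ε(E/K_∞)[p]` finite**: if `X^ε`
(the tree's concrete datum) is `Λ`-torsion with `char X^ε = (g)` and some coefficient of `g` is a
`p`-adic unit, then `μ(X^ε) = 0` (`muInvariant_eq_zero_iff_exists_isUnit_coeff_of_charIdeal_eq_span`) and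
§1 applies. [cite: Washington1997, §13.2] [cite: Kobayashi2003, Thm. 1.2] -/
theorem finite_signedSelmerInfty_pTorsion_of_charIdeal_eq_span_of_isUnit_coeff
    {γ : absoluteGaloisGroup K} (hγ : κ.IsTopGenerator γ)
    (hT : Module.IsTorsion (IwasawaAlgebra p) (signedSelmerDualData W κ ε hγ).X)
    {g : IwasawaAlgebra p} (hg : (signedSelmerDualData W κ ε hγ).charIdeal = Ideal.span {g})
    (hunit : ∃ k : ℕ, IsUnit (PowerSeries.coeff k g)) :
    Set.Finite {s : signedSelmerInfty W κ ε | p • s = 0} := by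
  haveI hfg : Module.Finite (IwasawaAlgebra p) (signedSelmerDualData W κ ε hγ).X :=
    (signedSelmerDualData W κ ε hγ).moduleFinite hγ
  have hμ : muInvariant p (signedSelmerDualData W κ ε hγ).X = 0 :=
    (muInvariant_eq_zero_iff_exists_isUnit_coeff_of_charIdeal_eq_span
      (signedSelmerDualData W κ ε hγ).X hT hg).mpr hunit
  exact finite_signedSelmerInfty_pTorsion_of_isTorsion_of_muInvariant_eq_zero W κ ε hγ hT hμ

end SignedMuZero

/-! ## §2 Over `ℚ`, CM, `p` odd good supersingular: Pollack–Rubin + a unit coefficient of `ϖ·L^{∓}` -/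

section PollackRubin

/-- `Sel₀(K_∞, E[p^∞])` only sees `K_∞ = K̄^{ker κ}`: finiteness of its `p`-torsion transports along an
equality of kernels (the fine Selmer group is Greenberg's strict Selmer group of `ker κ`; `subst`).
[folklore] -/
theorem finite_fineSelmerInfty_pTorsion_of_kerSubgroup_eq {K : Type u} [Field K] [NumberField K]
    (W : WeierstrassCurve K) {p : ℕ} [Fact p.Prime] {κ₀ κ : ZpExtension K p}
    (h : κ₀.kerSubgroup = κ.kerSubgroup)
    (hfin : Set.Finite {s : W.fineSelmerInfty κ₀ | p • s = 0}) :
    Set.Finite {s : W.fineSelmerInfty κ | p • s = 0} := by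
  have aux : ∀ {H₀ H : Subgroup (absoluteGaloisGroup K)} [H₀.Normal] [H.Normal], H₀ = H →
      Set.Finite {s : GreenbergSelmer.strictSelmerGroupOver H₀ (W.geomPrimaryTorsion p) p
        (GreenbergSelmer.fineData (W.geomPrimaryTorsion p) p) | p • s = 0} →
      Set.Finite {s : GreenbergSelmer.strictSelmerGroupOver H (W.geomPrimaryTorsion p) p
        (GreenbergSelmer.fineData (W.geomPrimaryTorsion p) p) | p • s = 0} := by
    intro H₀ H _ _ hH hf
    subst hH
    exact hf
  exact aux h hfin

/-- **Pollack–Rubin + a unit coefficient ⟹ `Sel^ε(W/ℚ_∞)[p]` finite.** Let `W/ℚ` be globally minimal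
with CM, `p ≠ 2` of good supersingular reduction (`GoodSS`), `ε` a sign, `(κ, γ)` the cyclotomic datum
in the fact's normalisation (`κ` cyclotomic, `κ γ = 1`, `γ` a cyclotomic variable), `f` a newform of `W`,
`ϖ ∈ ℚ` with `ϖ · Ω_W = Ω⁺_f`, `(L⁺, L⁻)` a Pollack pair, and suppose ONE coefficient of
`ϖ · L^{∓}` (`L⁻` for `ε = 1`, `L⁺` for `ε = −1`, Kobayashi's labelling) is a `p`-adic unit. Then the
`p`-torsion of `Sel^ε(W/ℚ_∞)` is finite: Pollack–Rubin gives `X^ε` torsion with `char X^ε = (g)`,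
`ι g = ϖ · ι L^{∓}`, so that coefficient of `g` is a unit and §1 applies.
[cite: PollackRubin2004, Theorem (p. 448) = Thm. 7.3] [cite: Kobayashi2003, (3.6) (p. 7)]
[cite: Pollack2003, Thm. 5.6 and Cor. 5.11] -/
theorem finite_signedSelmerInfty_pTorsion_of_pollackRubin
    (hPR : PollackRubin2004.mainTheorem_signedCharIdeal_eq_of_cm) (W : WeierstrassCurve ℚ) [W.IsElliptic]
    [W.IsGloballyMinimal] {p : ℕ} [Fact p.Prime] (hcm : W.HasCM) (hp : p ≠ 2) (hss : GoodSS W p)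
    (ε : ℤˣ) {κ : ZpExtension ℚ p} {γ : absoluteGaloisGroup ℚ} (hκ : κ.IsCyclotomic)
    (hγ : κ.IsTopGenerator γ) (hγc : IsCyclotomicVariable p γ)
    [NeZero (W.conductorNorm ℤ)] (f : CuspForm (Gamma0 (W.conductorNorm ℤ)) 2) (hf : IsNewformOf W f)
    (ϖ : ℚ) (hϖ : (ϖ : ℝ) * W.realPeriodRat = plusPeriod f) (Lplus Lminus : IwasawaAlgebra p)
    (hL : Supersingular.IsPollackPair f p Lplus Lminus)
    (hunit : ∃ k : ℕ, ‖(ϖ : ℚ_[p]) *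
      PowerSeries.coeff k (iwasawaToPowerSeries p (if ε = 1 then Lminus else Lplus))‖ = 1) :
    Set.Finite {s : signedSelmerInfty W κ ε | p • s = 0} := by
  obtain ⟨hT, g, hg, hι⟩ := hPR W p hcm hp hss ε κ γ hκ hγ hγc f hf ϖ hϖ Lplus Lminus hL
    (signedSelmerDualData W κ ε hγ)
  obtain ⟨k, hk⟩ := hunit
  refine finite_signedSelmerInfty_pTorsion_of_charIdeal_eq_span_of_isUnit_coeff W κ ε hγ hT hg ⟨k, ?_⟩
  have hcoeff : ((PowerSeries.coeff k g : ℤ_[p]) : ℚ_[p]) =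
      (ϖ : ℚ_[p]) * PowerSeries.coeff k (iwasawaToPowerSeries p (if ε = 1 then Lminus else Lplus)) := by
    have h := congrArg (PowerSeries.coeff k) hι
    rw [PowerSeries.coeff_C_mul] at h
    rw [← h, iwasawaToPowerSeries, PowerSeries.coeff_map]
    rfl
  rw [PadicInt.isUnit_iff, ← PadicInt.padic_norm_e_of_padicInt, hcoeff]
  exact hk

/-- The normalised cyclotomic datum exists: `κ` cyclotomic with a topological generator `γ` that is a
cyclotomic variable (tree theorem `exists_isCyclotomic_isTopGenerator_isCyclotomicVariable_holds`).
[cite: Washington1997, §13.1] -/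
theorem exists_normalised_cyclotomic (p : ℕ) [Fact p.Prime] :
    ∃ κ : ZpExtension ℚ p, κ.IsCyclotomic ∧
      ∃ γ : absoluteGaloisGroup ℚ, κ.IsTopGenerator γ ∧ IsCyclotomicVariable p γ :=
  exists_isCyclotomic_isTopGenerator_isCyclotomicVariable_holds p

/-- **(A) at `(W, p)` for EVERY cyclotomic `κ` from a CM good-supersingular Pollack–Rubin certificate.**
Under the hypotheses of `finite_signedSelmerInfty_pTorsion_of_pollackRubin` stated at the NORMALISED
datum (supplied here by `exists_normalised_cyclotomic`; the newform / period / Pollack-pair / unit-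
coefficient data do not mention `κ`): for every cyclotomic `ℤ_p`-extension datum `κ` the Pontryagin dual
of `Sel₀(ℚ_∞, W[p^∞])` is finitely generated over `ℤ_p` (Coates–Sujatha's (A), the tree's `∃`-form):
`Sel^ε[p]` finite at `κ₀` (§2) ⟹ `Sel₀[p]` finite at `κ₀` (bridge p466275, bad set from
`exists_finset_forall_not_mem_good`) ⟹ at `κ` (`ker κ = ker κ₀`) ⟹ (A) (`conjA_of_finite_fineSelmerInfty_pTorsion`).
[cite: PollackRubin2004, Theorem (p. 448)] [cite: CoatesSujatha2005, §3 (Conjecture A)] -/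
theorem conjA_rat_of_pollackRubin (hPR : PollackRubin2004.mainTheorem_signedCharIdeal_eq_of_cm)
    (W : WeierstrassCurve ℚ) [W.IsElliptic] [W.IsGloballyMinimal] {p : ℕ} [Fact p.Prime] (hcm : W.HasCM) (hp : p ≠ 2) (hss : GoodSS W p) (ε : ℤˣ)
    [NeZero (W.conductorNorm ℤ)] (f : CuspForm (Gamma0 (W.conductorNorm ℤ)) 2) (hf : IsNewformOf W f)
    (ϖ : ℚ) (hϖ : (ϖ : ℝ) * W.realPeriodRat = plusPeriod f) (Lplus Lminus : IwasawaAlgebra p)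
    (hL : Supersingular.IsPollackPair f p Lplus Lminus)
    (hunit : ∃ k : ℕ, ‖(ϖ : ℚ_[p]) *
      PowerSeries.coeff k (iwasawaToPowerSeries p (if ε = 1 then Lminus else Lplus))‖ = 1) :
    ∀ (κ : ZpExtension ℚ p), κ.IsCyclotomic →
      ∃ (γ : absoluteGaloisGroup ℚ) (D : W.FineSelmerDualData κ γ),
        Module.Finite ℤ_[p] (RestrictScalars ℤ_[p] (IwasawaAlgebra p) D.X) := by
  obtain ⟨κ₀, hκ₀, γ₀, hγ₀, hγ₀c⟩ := exists_normalised_cyclotomic p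
  obtain ⟨S, hS⟩ := exists_finset_forall_not_mem_good W p
  have hfin₀ := finite_signedSelmerInfty_pTorsion_of_pollackRubin hPR W hcm hp hss ε hκ₀ hγ₀ hγ₀c f hf
    ϖ hϖ Lplus Lminus hL hunit
  have h0₀ : Set.Finite {s : W.fineSelmerInfty κ₀ | p • s = 0} :=
    FineSelmerLeSignedSelmer.finite_fineSelmerInfty_pTorsion_of_finite_signedSelmerInfty_pTorsion W κ₀
      S hS ε hfin₀
  intro κ hκ
  have h0 : Set.Finite {s : W.fineSelmerInfty κ | p • s = 0} :=
    finite_fineSelmerInfty_pTorsion_of_kerSubgroup_eq W (IsCyclotomic.kerSubgroup_eq hκ₀ hκ) h0₀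
  obtain ⟨γ, hγ⟩ : ∃ γ : absoluteGaloisGroup ℚ, κ.IsTopGenerator γ := κ.surjective (Multiplicative.ofAdd 1)
  exact FineSelmerLeSignedSelmer.conjA_of_finite_fineSelmerInfty_pTorsion W κ hγ h0

end PollackRubin

/-! ## §3 The bridge with the finite bad set discharged -/

section BridgeFree

variable {K : Type u} [Field K] [NumberField K] (W : WeierstrassCurve K) [W.IsElliptic] {p : ℕ}
  [Fact p.Prime] (κ : ZpExtension K p)

/-- **`Sel₀(K_∞, E[p^∞]) ≤ Sel^ε(E/K_∞)` for every elliptic curve over a number field, every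
`ℤ_p`-extension and every sign** — p466275's `fineSelmerInfty_le_signedSelmerInfty` with its finite
bad set supplied by x1b's `exists_finset_forall_not_mem_good` (finitely many bad places and places
above `p`). [cite: Kobayashi2003, Def. 1.1] [cite: CoatesSujatha2005, §3] [cite: SilvermanAEC2009, Rem. VIII.1.3] -/
theorem fineSelmerInfty_le_signedSelmerInfty' (ε : ℤˣ) :
    W.fineSelmerInfty κ ≤ signedSelmerInfty W κ ε := by
  obtain ⟨S, hS⟩ := exists_finset_forall_not_mem_good W p
  exact FineSelmerLeSignedSelmer.fineSelmerInfty_le_signedSelmerInfty W κ S hS ε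

/-- (A) over `ℚ` from the finiteness of `Sel^ε(W/ℚ_∞)[p]` at every cyclotomic datum, bad set
discharged (`conjA_rat_of_finite_signedSelmerInfty_pTorsion` of p466275).
[cite: CoatesSujatha2005, §3 (Conjecture A)] [cite: Kobayashi2003, Thm. 1.2] -/
theorem conjA_rat_of_finite_signedSelmerInfty_pTorsion' (W : WeierstrassCurve ℚ) [W.IsElliptic]
    {p : ℕ} [Fact p.Prime] (ε : ℤˣ)
    (hfin : ∀ (κ : ZpExtension ℚ p), κ.IsCyclotomic →
      Set.Finite {s : signedSelmerInfty W κ ε | p • s = 0}) :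
    ∀ (κ : ZpExtension ℚ p), κ.IsCyclotomic →
      ∃ (γ : absoluteGaloisGroup ℚ) (D : W.FineSelmerDualData κ γ),
        Module.Finite ℤ_[p] (RestrictScalars ℤ_[p] (IwasawaAlgebra p) D.X) := by
  obtain ⟨S, hS⟩ := exists_finset_forall_not_mem_good W p
  exact FineSelmerLeSignedSelmer.conjA_rat_of_finite_signedSelmerInfty_pTorsion W S hS ε hfin

end BridgeFree

/-! ## §4 The row road: Upper at a ♯ row from a congruent CM good-supersingular anchor -/

section Road

/-- **Upper at a wild `r_an = 0` row with `W[3]` irreducible from (A) AT THE ROW** (g3's chain in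
`…WildFineSelmerOrdinaryAnchor.lean`, made public): Kato's A161″ conclusion in the fine-Selmer reading
(`hKatoA` = p420034 at the Conj-A binding, `WildFineSelmerCongruence.x4UpperOfFineMuZero_conjA`) in
Miller's currency (`exists_shaAn_le_add_torsion_of_katoCurrency`; the torsion term vanishes on an
irreducible row). [cite: Kato2004Asterisque, Thm. 14.5 (3) (p. 236), Prop. 14.16 (2) (p. 244)]
[cite: Miller2011LMS, Def. 1.1] -/
theorem missingUpperBoundAt_wild_of_conjA
    (hKatoA :
      Kato2004.rankZero_padicValNat_sha_add_padicValNat_tamagawa_le_of_additive_potGood_of_irreducible_of_fineSelmerDual_fg)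
    (hGZK : rank_eq_analyticRank_of_analyticRank_le_one) (hmod : hasEntireLFunction_rat)
    (W : WeierstrassCurve ℚ) [W.IsElliptic] [W.IsGloballyMinimal] [Fact (3 : ℕ).Prime]
    (hr : W.analyticRank = 0) (hO : ClassO6 W 3) (hirr : W.HasIrreducibleModPGaloisRep 3)
    (hA : ∀ (κ : ZpExtension ℚ 3), κ.IsCyclotomic →
      ∃ (γ : absoluteGaloisGroup ℚ) (D : W.FineSelmerDualData κ γ),
        Module.Finite ℤ_[3] (RestrictScalars ℤ_[3] (IwasawaAlgebra 3) D.X)) :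
    MissingUpperBoundAt W 3 := by
  have hL : W.entireLFunction 1 ≠ 0 := (W.analyticRank_eq_zero_iff_holds (hmod W)).mp hr
  obtain ⟨-, hfin⟩ := hGZK W (by rw [hr]; exact zero_le_one)
  obtain ⟨q₀, hq₀, hle⟩ := WildFineSelmerCongruence.x4UpperOfFineMuZero_conjA hKatoA W 3 hO.1 hO.2.1.1
    hO.2.1.2 hO.padicValRat_j_nonneg hirr (fun κ hκ ↦ hA κ hκ) hL hfin
  have ht0 : padicValNat 3 W.torsionOrder = 0 := padicValNat_torsionOrder_eq_zero_of_irreducible W 3 hirr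
  obtain ⟨q, hq, hle'⟩ := exists_shaAn_le_add_torsion_of_katoCurrency hGZK hmod W 3 hr hfin hq₀
    (by rw [ht0, Nat.cast_zero, mul_zero, add_zero]; exact hle)
  refine ⟨q, hq, ?_⟩
  rw [ht0, Nat.cast_zero, add_zero] at hle'
  exact hle'

/-- **THE SUPERSINGULAR CM-ANCHOR ROAD, row form (K9 currency).** Granted Lim–Sujatha (`hLS`, p445851),
Kato's fine-Selmer reading (`hKatoA`, p420034), Pollack–Rubin (`hPR`), GZK and modularity: on an O6 row
`W` of analytic rank `0` with `W[3]` irreducible, ONE globally minimal CM curve `W′/ℚ` with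
`W′[3] ≃ W[3]` (`ModPCongruent W′ W 3`) and GOOD SUPERSINGULAR reduction at `3`, together with a
newform `f` of `W′`, `ϖ·Ω_{W′} = Ω⁺_f`, a Pollack pair `(L⁺,L⁻)` at `3`, a sign `ε` and ONE `3`-adic
unit coefficient of `ϖ·L^{∓}`, gives the upper half `ord₃ #Ш(W) ≤ ord₃ #Ш_an(W)` — the 3Nn-row
certificate shape (anchors: CM by a field in which `3` is inert). Conditional; nothing booked; no
census number is an input. [cite: PollackRubin2004, Theorem (p. 448)] [cite: LimSujatha2018, §3 Prop. 3.2]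
[cite: Kato2004Asterisque, Thm. 14.5 (3) (p. 236), Prop. 14.16 (2) (p. 244)] [cite: Miller2011LMS, Def. 1.1] -/
theorem missingUpperBoundAt_wild_of_supersingularCMAnchor
    (hLS : LimSujatha2018.prop32_fineSelmerDual_moduleFinite_iff_of_torsionIso)
    (hKatoA :
      Kato2004.rankZero_padicValNat_sha_add_padicValNat_tamagawa_le_of_additive_potGood_of_irreducible_of_fineSelmerDual_fg)
    (hPR : PollackRubin2004.mainTheorem_signedCharIdeal_eq_of_cm)
    (hGZK : rank_eq_analyticRank_of_analyticRank_le_one) (hmod : hasEntireLFunction_rat)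
    (W : WeierstrassCurve ℚ) [W.IsElliptic] [W.IsGloballyMinimal] [Fact (3 : ℕ).Prime]
    (hr : W.analyticRank = 0) (hO : ClassO6 W 3) (hirr : W.HasIrreducibleModPGaloisRep 3)
    (W' : WeierstrassCurve ℚ) [W'.IsElliptic] [W'.IsGloballyMinimal] (hcong : ModPCongruent W' W 3)
    (hcm' : W'.HasCM) (hss' : GoodSS W' 3) (ε : ℤˣ)
    [NeZero (W'.conductorNorm ℤ)] (f : CuspForm (Gamma0 (W'.conductorNorm ℤ)) 2) (hf : IsNewformOf W' f)
    (ϖ : ℚ) (hϖ : (ϖ : ℝ) * W'.realPeriodRat = plusPeriod f) (Lplus Lminus : IwasawaAlgebra 3)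
    (hL : Supersingular.IsPollackPair f 3 Lplus Lminus)
    (hunit : ∃ k : ℕ, ‖(ϖ : ℚ_[3]) *
      PowerSeries.coeff k (iwasawaToPowerSeries 3 (if ε = 1 then Lminus else Lplus))‖ = 1) :
    MissingUpperBoundAt W 3 :=
  missingUpperBoundAt_wild_of_conjA hKatoA hGZK hmod W hr hO hirr
    (WildFineSelmerCongruenceFact.conjA_of_modPCongruent hLS (by norm_num) hcong
      (conjA_rat_of_pollackRubin hPR W' hcm' (by norm_num) hss' ε f hf ϖ hϖ Lplus Lminus hL hunit))

end Road

end Summit.BirchSwinnertonDyer.BirchSwinnertonDyer.Theorems.WildFineSelmerSupersingularCMAnchor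

end
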